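import Summits.BirchSwinnertonDyer.BirchSwinnertonDyer.Theorems.QuadraticBranchSignedControlPlusEtaNonsurjUnitRows
import Summits.BirchSwinnertonDyer.Rank1Residual.X11b.ChaPairsMinimality
import Literature.NumberTheory.EllipticCurves.IsogenyHasCMIffJMemProofs
import HarnessLib

/-!
# Route `QuadraticBranchSignedControl` (rung K8, cell `bsd-potss`), residual crux
# `PlusEtaMainConjectureNonsurj` (stmt-BirchSwinnertonDyer-19606): RECORD SHAPE for the CM unit rows —
# Kobayashi's even main conjecture at `η` for every good supersingular `a_p = 0` model of the `p*`-twist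
# of a LITERAL CM curve `W = [a₁,…,a₆]` of analytic rank `0` with `p ∤ #Ш(W)_an·Tam(W)`, CM decided in
# the kernel from `j = c₄³/Δ` (seat `bsd-potss-k8eta-c2` g2)

WHAT. `…PlusEtaNonsurjUnitRows` (this seat, p473356) proves (C1⁺_η)(V,p) on the CM unit rows from
modularity + GZK + Burungale–Flach bsd.S28 + two table integers. This file is the per-row RECORD SHAPE
consumed by the record files `…PlusEtaNonsurjCMUnitRecordsNN.lean`: for a literal integer equation
`W = ⟨a₁,…,a₆⟩` (elliptic, globally minimal — instance binders, decided per row by x11b's Kraus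
criterion), `j(W) = c₄³/Δ ∈` the thirteen CM values (DECIDABLE: `ratCurve_j` + the tree's theorem
`hasCM_iff_j_mem_holds`), `p ≥ 5`, `r_an(W) = 0`, `#Ш(W)_an = s` with `p ∤ s`, `Tam(W) = cp` with
`p ∤ cp` (Cremona `allbsd` entries, displayed): every globally minimal `V` with `C • W^{(p*)} = V`, good
at `p`, `a_p(V) = 0` satisfies `QuadraticBranchPlusEtaMainConjectureAt V p`.
* `ratCurve_c₄`, `ratCurve_j` — `c₄` and `j` of the literal rational curve as the recheck integers.
* `quadraticBranchPlusEtaMainConjectureAt_of_hasCM_partner_of_shaAn_unit` — the CM unit-row road with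
  `W.HasCM` (instead of `V.HasCM`) as the CM binder.
* `etaMC_cm_r0_of_ainvs` — the record shape.

HONEST FRAMING (cell `bsd-potss`, run/shared/lean/pub/bsd-potss/; FULL-BSD rank ≤ 1 programme,
tranche 1b, HUMAN RULING D-0036/D-0074): BOOKKEEPING THEOREMS ONLY — no definition, no named
Literature fact minted, no Summits-side `def … : Prop`, no `sorry`, axioms standard. CONDITIONAL on
modularity, GZK, Burungale–Flach 2024 (bsd.S28) — named facts — and on the DISPLAYED per-row table
entries (`r_an`, `#Ш_an`, `Tam`). Nothing is booked; no label / mark / count moves; the class-wide crux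
19606 and its stub `stub_etaMC_cm` stay OPEN; `BSD(W,p)` is bsd.S28, claimed for no new pair.
`--supports stmt-BirchSwinnertonDyer-19606`.

References: [BurungaleFlach2024] Thm. 1.1 + Cor. 2; [Kobayashi2003] §4 Even main conjecture (p. 8);
[SilvermanAEC2009] III.1, VII.1 Rem. 1.1, App. C §11; [Kraus1989]; [Cremona1997] Table 1.
-/

set_option autoImplicit false
set_option linter.dupNamespace false

noncomputable section

open scoped Classical

open CongruenceSubgroup Field Function NumberField IsDedekindDomain WeierstrassCurve
open Literature.NumberTheory.EllipticCurves
open Literature.NumberTheory.EllipticCurves.ModularForms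
open Literature.NumberTheory.EllipticCurves.Rank1Residual
open Literature.NumberTheory.EllipticCurves.Rank1Residual.Typed
open Literature.NumberTheory.EllipticCurves.Rank1Residual.X11RankOneCertificates
open Literature.NumberTheory.GaloisRepresentations
open Summit.BirchSwinnertonDyer.Rank1Residual.Additive
open Summit.BirchSwinnertonDyer.Rank1Residual.X11b

namespace Summit.BirchSwinnertonDyer.BirchSwinnertonDyer.Theorems

namespace EtaUnitRows

/-! ## §1 `c₄` and `j` of a literal rational equation -/

/-- `c₄` of the rational curve `[a₁,…,a₆]` is the recheck integer `c4Of`. [cite: SilvermanAEC2009, III.1] -/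
theorem ratCurve_c₄ (a1 a2 a3 a4 a6 : ℤ) :
    (⟨a1, a2, a3, a4, a6⟩ : WeierstrassCurve ℚ).c₄ = ((c4Of [a1, a2, a3, a4, a6] : ℤ) : ℚ) := by
  simp only [WeierstrassCurve.c₄, WeierstrassCurve.b₂, WeierstrassCurve.b₄, c4Of, invariants]
  push_cast
  ring

/-- `j = c₄³/Δ` of the rational curve `[a₁,…,a₆]` as the recheck integers (decidable CM test through the
tree's theorem `hasCM_iff_j_mem_holds`). [cite: SilvermanAEC2009, III.1 (p. 42), App. C §11] -/
theorem ratCurve_j (a1 a2 a3 a4 a6 : ℤ) [(⟨a1, a2, a3, a4, a6⟩ : WeierstrassCurve ℚ).IsElliptic] :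
    (⟨a1, a2, a3, a4, a6⟩ : WeierstrassCurve ℚ).j =
      ((c4Of [a1, a2, a3, a4, a6] ^ 3 : ℤ) : ℚ) / ((discOf [a1, a2, a3, a4, a6] : ℤ) : ℚ) := by
  rw [WeierstrassCurve.j, Units.val_inv_eq_inv_val, coe_Δ', ratCurve_Δ, ratCurve_c₄]
  push_cast
  rw [div_eq_inv_mul]

/-! ## §2 The CM unit-row road with the CM binder on the partner `W` -/

section Road

variable (W : WeierstrassCurve ℚ) [W.IsElliptic] [W.IsGloballyMinimal] (p : ℕ) [hp : Fact p.Prime]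

/-- **The CM unit-row road, CM binder on `W`.** `W` CM and globally minimal, `p ≥ 5`, `V` a globally
minimal model of `W^{(p*)}` good at `p` with `a_p(V) = 0`, `L(W,1) ≠ 0`, `v_p(#Ш(W)_an) ≤ 0`,
`p ∤ Tam(W)` ⟹ (C1⁺_η)(V,p): bsd.S28 gives `BSD(W,p)` and `…_of_bsdp_of_shaAn_unit` concludes.
Named facts: modularity, GZK, bsd.S28. CONDITIONAL; nothing booked.
[cite: BurungaleFlach2024, Thm 1.1 and Cor. 2] [cite: Kobayashi2003, §4 Even main conjecture (p. 8)] -/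
theorem quadraticBranchPlusEtaMainConjectureAt_of_hasCM_partner_of_shaAn_unit
    (hmod : hasEntireLFunction_rat) (hGZK : rank_eq_analyticRank_of_analyticRank_le_one)
    (hS28 : bsdTriple_of_hasCM_of_L_one_ne_zero)
    (V : WeierstrassCurve ℚ) [V.IsElliptic] [V.IsGloballyMinimal] (C : VariableChange ℚ)
    (hp5 : 5 ≤ p) (hCV : C • W.quadraticTwist ((-1) ^ (p / 2) * p) = V)
    (hgood : V.HasGoodReductionAtPrime p) (hap : V.frobeniusTrace p = 0) (hCMW : W.HasCM)
    (hLW : W.entireLFunction 1 ≠ 0)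
    (hsha : ∃ s : ℚ, shaAn W = (s : ℂ) ∧ padicValRat p s ≤ 0) (hTam : ¬ p ∣ W.tamagawaProduct) :
    QuadraticBranchPlusEtaMainConjectureAt V p :=
  quadraticBranchPlusEtaMainConjectureAt_of_bsdp_of_shaAn_unit W p hmod hGZK V C hp5 hCV hgood hap
    (forall_bsdp_of_bsdTriple' W (hS28 W hCMW hLW) p hp.out) hLW hsha hTam

end Road

/-! ## §3 The record shape for a literal CM equation -/

/-- **RECORD SHAPE (CM unit rows of crux 19606).** For a literal integer equation `W = ⟨a₁,…,a₆⟩`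
(elliptic and globally minimal: instance binders), with `c₄³/Δ ∈` the thirteen CM `j`-invariants
(`hj`, decidable), `p ≥ 5`, `r_an(W) = 0` (`hr`), `#Ш(W)_an = s ∈ ℕ` with `p ∤ s` and `Tam(W) = cp`
with `p ∤ cp` (Cremona's table, displayed): Kobayashi's even main conjecture at `η` holds at `(V,p)`
for every globally minimal `V` with `C • W^{(p*)} = V`, good at `p`, `a_p(V) = 0`. Named facts:
modularity, GZK, Burungale–Flach bsd.S28. CONDITIONAL; per row; nothing booked.
[cite: BurungaleFlach2024, Thm 1.1 and Cor. 2] [cite: Kobayashi2003, §4 Even main conjecture (p. 8)]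
[cite: SilvermanAEC2009, App. C §11] [cite: Cremona1997, Table 1] -/
theorem etaMC_cm_r0_of_ainvs (hmod : hasEntireLFunction_rat)
    (hGZK : rank_eq_analyticRank_of_analyticRank_le_one) (hS28 : bsdTriple_of_hasCM_of_L_one_ne_zero)
    (a1 a2 a3 a4 a6 : ℤ) [(⟨a1, a2, a3, a4, a6⟩ : WeierstrassCurve ℚ).IsElliptic]
    [(⟨a1, a2, a3, a4, a6⟩ : WeierstrassCurve ℚ).IsGloballyMinimal]
    (hj : ((c4Of [a1, a2, a3, a4, a6] ^ 3 : ℤ) : ℚ) / ((discOf [a1, a2, a3, a4, a6] : ℤ) : ℚ) ∈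
      cmJInvariants)
    (p : ℕ) [Fact p.Prime] (hp5 : 5 ≤ p)
    (hr : (⟨a1, a2, a3, a4, a6⟩ : WeierstrassCurve ℚ).analyticRank = 0) {s cp : ℕ}
    (hs : shaAn (⟨a1, a2, a3, a4, a6⟩ : WeierstrassCurve ℚ) = (s : ℂ)) (hps : ¬ p ∣ s)
    (hcp : (⟨a1, a2, a3, a4, a6⟩ : WeierstrassCurve ℚ).tamagawaProduct = cp) (hpcp : ¬ p ∣ cp)
    (V : WeierstrassCurve ℚ) [V.IsElliptic] [V.IsGloballyMinimal] (C : VariableChange ℚ)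
    (hCV : C • (⟨a1, a2, a3, a4, a6⟩ : WeierstrassCurve ℚ).quadraticTwist ((-1) ^ (p / 2) * p) = V)
    (hgood : V.HasGoodReductionAtPrime p) (hap : V.frobeniusTrace p = 0) :
    QuadraticBranchPlusEtaMainConjectureAt V p := by
  have hCMW : (⟨a1, a2, a3, a4, a6⟩ : WeierstrassCurve ℚ).HasCM :=
    (hasCM_iff_j_mem_holds _).mpr (by rw [ratCurve_j]; exact hj)
  have hLW : (⟨a1, a2, a3, a4, a6⟩ : WeierstrassCurve ℚ).entireLFunction 1 ≠ 0 :=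
    ((⟨a1, a2, a3, a4, a6⟩ : WeierstrassCurve ℚ).analyticRank_eq_zero_iff_holds (hmod _)).mp hr
  have hsha : ∃ t : ℚ, shaAn (⟨a1, a2, a3, a4, a6⟩ : WeierstrassCurve ℚ) = (t : ℂ) ∧ padicValRat p t ≤ 0 := by
    refine ⟨(s : ℚ), by rw [hs]; push_cast; rfl, ?_⟩
    rw [padicValRat.of_nat, padicValNat.eq_zero_of_not_dvd hps]
    simp
  have hTam : ¬ p ∣ (⟨a1, a2, a3, a4, a6⟩ : WeierstrassCurve ℚ).tamagawaProduct := by rw [hcp]; exact hpcp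
  exact quadraticBranchPlusEtaMainConjectureAt_of_hasCM_partner_of_shaAn_unit _ p hmod hGZK hS28 V C hp5 hCV
    hgood hap hCMW hLW hsha hTam

end EtaUnitRows

end Summit.BirchSwinnertonDyer.BirchSwinnertonDyer.Theorems

end
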